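import Mathlib
import Literature.NumberTheory.Transcendental.KZHyperbolicLadder
import Literature.NumberTheory.Transcendental.KZCalculusProofs
import Literature.NumberTheory.Transcendental.KZLogCalculusProofs
import Literature.NumberTheory.Transcendental.KZSemiCanonicalReductionProofs
import Literature.NumberTheory.Transcendental.KZDominatedFamilyRelations
import Summits.KontsevichZagierPeriods.KontsevichZagierPeriods.Theorems.HyperbolicBlochOffTetraSectorKernelLadderFamilyExists

/-!
# `OffTetraSectorKernel` (stmt-KontsevichZagierPeriods-10557), line `odd-hyperbolic-ladder`:
# vertical cuts of a `ℚ̄`-geodesic polygon of `ℍ²` — auxiliary lemmas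

Helpers for the stub `stub_verticalCuts` (file `HyperbolicBlochOffTetraSectorKernelStubVerticalCuts`):

* sign constancy of the constraints of a polygon on a breakpoint-free interval (intermediate value
  theorem): `vcut_sign_const`, `vcut_affine_sign`, `vcut_circle_sign`, `vcut_circle_order`;
* bookkeeping of open intervals: `vcut_Iio_ne_Ioo`, `vcut_Ioi_ne_Ioo`, `vcut_Ioo_eq_Ioo`;
* null sets in the plane: vertical walls `vcut_volume_walls` and upper semicircles `vcut_volume_arc`
  (Fubini), and the `ℚ`-semialgebraic vertical strips `vcut_isSemialgebraic_strip`;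
* two consequences of Kontsevich–Zagier's rule (1a): domain additivity with two pieces up to null
  sets `vcut_two_piece`, and the re-indexing of a signed family of V-piece representations
  `vcut_flatten`.

References: M. Kontsevich, D. Zagier, *Periods* (2001), §1.2 rule (1).
-/

noncomputable section

open Set MeasureTheory
open Literature.NumberTheory.Transcendental Literature.ModelTheory.ExponentialFields

namespace Summit.KontsevichZagierPeriods.HyperbolicBloch.OffTetraSectorKernel

/-! ## Sign constancy on breakpoint-free intervals -/

/-- A continuous real function without zeros on a preconnected set has constant strict sign there
(intermediate value theorem). [folklore] -/
theorem vcut_sign_const {J : Set ℝ} (hJ : IsPreconnected J) {f : ℝ → ℝ} (hf : Continuous f)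
    (h0 : ∀ x ∈ J, f x ≠ 0) : (∀ x ∈ J, 0 < f x) ∨ (∀ x ∈ J, f x < 0) := by
  by_contra h
  simp only [not_or, not_forall, not_lt, exists_prop] at h
  obtain ⟨⟨x, hx, hfx⟩, ⟨y, hy, hfy⟩⟩ := h
  obtain ⟨z, hz, hfz⟩ := hJ.intermediate_value hx hy hf.continuousOn ⟨hfx, hfy⟩
  exact h0 z hz hfz

/-- Sign constancy of an affine constraint `e (α x − γ)` on a preconnected set avoiding its zero
`γ / α`. [folklore] -/
theorem vcut_affine_sign {J : Set ℝ} (hJ : IsPreconnected J) (e α γ : ℝ)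
    (h : ∀ x ∈ J, α ≠ 0 → x ≠ γ / α) :
    (∀ x ∈ J, 0 < e * (α * x - γ)) ∨ (∀ x ∈ J, e * (α * x - γ) ≤ 0) := by
  by_cases hα : α = 0
  · subst hα
    rcases lt_or_ge 0 (e * (0 - γ)) with h1 | h1
    · exact Or.inl fun x _ => by simpa using h1
    · exact Or.inr fun x _ => by simpa using h1
  by_cases he : e = 0
  · exact Or.inr fun x _ => by simp [he]
  have hf : Continuous fun x : ℝ => e * (α * x - γ) := by fun_prop
  have h0 : ∀ x ∈ J, e * (α * x - γ) ≠ 0 := by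
    intro x hx hx0
    rcases mul_eq_zero.1 hx0 with h2 | h2
    · exact he h2
    · exact h x hx hα (by field_simp; linarith)
  rcases vcut_sign_const hJ hf h0 with h1 | h1
  · exact Or.inl h1
  · exact Or.inr fun x hx => (h1 x hx).le

/-- Sign constancy of a semicircle constraint `γ − (x − α)²` on a preconnected set avoiding its zeros
`α ± √γ`. [folklore] -/
theorem vcut_circle_sign {J : Set ℝ} (hJ : IsPreconnected J) (α γ : ℝ)
    (h₁ : ∀ x ∈ J, x ≠ α - Real.sqrt γ) (h₂ : ∀ x ∈ J, x ≠ α + Real.sqrt γ) :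
    (∀ x ∈ J, 0 < γ - (x - α) ^ 2) ∨ (∀ x ∈ J, γ - (x - α) ^ 2 ≤ 0) := by
  have hf : Continuous fun x : ℝ => γ - (x - α) ^ 2 := by fun_prop
  have h0 : ∀ x ∈ J, γ - (x - α) ^ 2 ≠ 0 := by
    intro x hx hx0
    have hsq : (x - α) ^ 2 = γ := by linarith
    have habs : |x - α| = Real.sqrt γ := by rw [← hsq, Real.sqrt_sq_eq_abs]
    rcases abs_eq_abs.1 (habs.trans (abs_of_nonneg (Real.sqrt_nonneg γ)).symm) with h3 | h3
    · exact h₂ x hx (by linarith)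
    · exact h₁ x hx (by linarith)
  rcases vcut_sign_const hJ hf h0 with h1 | h1
  · exact Or.inl h1
  · exact Or.inr fun x hx => (h1 x hx).le

/-- Order constancy of two semicircle constraints on a preconnected set avoiding the abscissa of
their crossing (the difference of the two constraints is affine in `x`). [folklore] -/
theorem vcut_circle_order {J : Set ℝ} (hJ : IsPreconnected J) (α γ α' γ' : ℝ)
    (h : ∀ x ∈ J, α ≠ α' → x ≠ (α' ^ 2 - α ^ 2 + γ - γ') / (2 * (α' - α))) :
    (∀ x ∈ J, γ - (x - α) ^ 2 ≤ γ' - (x - α') ^ 2) ∨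
      (∀ x ∈ J, γ' - (x - α') ^ 2 ≤ γ - (x - α) ^ 2) := by
  by_cases hα : α = α'
  · subst hα
    rcases le_total γ γ' with h1 | h1
    · exact Or.inl fun x _ => by linarith
    · exact Or.inr fun x _ => by linarith
  have hf : Continuous fun x : ℝ => (γ - (x - α) ^ 2) - (γ' - (x - α') ^ 2) := by fun_prop
  have h0 : ∀ x ∈ J, (γ - (x - α) ^ 2) - (γ' - (x - α') ^ 2) ≠ 0 := by
    intro x hx hx0
    have hne : (2 : ℝ) * (α' - α) ≠ 0 := mul_ne_zero two_ne_zero (sub_ne_zero.2 (Ne.symm hα))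
    refine h x hx hα ?_
    rw [eq_div_iff hne]
    linear_combination (-1 : ℝ) * hx0
  rcases vcut_sign_const hJ hf h0 with h1 | h1
  · exact Or.inr fun x hx => by linarith [h1 x hx]
  · exact Or.inl fun x hx => by linarith [h1 x hx]

/-! ## Intervals, null walls and null arcs -/

/-- An open left ray is not a bounded open interval. [folklore] -/
theorem vcut_Iio_ne_Ioo (m u v : ℝ) : Iio m ≠ Ioo u v := by
  intro h
  have : min u m - 1 ∈ Iio m := by
    simp only [mem_Iio]; linarith [min_le_right u m]
  rw [h] at this
  linarith [this.1, min_le_left u m]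

/-- An open right ray is not a bounded open interval. [folklore] -/
theorem vcut_Ioi_ne_Ioo (m u v : ℝ) : Ioi m ≠ Ioo u v := by
  intro h
  have : max v m + 1 ∈ Ioi m := by
    simp only [mem_Ioi]; linarith [le_max_right v m]
  rw [h] at this
  linarith [this.2, le_max_left v m]

/-- Non-empty bounded open intervals determine their end points. [folklore] -/
theorem vcut_Ioo_eq_Ioo {a b u v : ℝ} (hab : a < b) (h : Ioo a b = Ioo u v) :
    u = a ∧ v = b := by
  have huv : u < v := by
    have hn := nonempty_Ioo.2 hab
    rw [h] at hn
    exact nonempty_Ioo.1 hn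
  constructor
  · rw [← csInf_Ioo hab, h, csInf_Ioo huv]
  · rw [← csSup_Ioo hab, h, csSup_Ioo huv]

/-- Vertical walls over finitely many abscissae are Lebesgue-null in the plane. [folklore] -/
theorem vcut_volume_walls (B : Finset ℝ) : volume {p : Fin 2 → ℝ | p 0 ∈ B} = 0 :=
  Measure.pi_eval_preimage_null (fun _ : Fin 2 => (volume : Measure ℝ)) (i := 0)
    (B.finite_toSet.measure_zero volume)

/-- SUB-GOAL `vcut_volume_arc` (registered on the crux for this auxiliary file): an upper semicircle
(the graph of `x ↦ √(c − (x − a)²)`, the arc separating the two V-pieces of a strip between two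
semicircles) is Lebesgue-null in the plane (Fubini: its vertical fibres are single points). [folklore] -/
theorem vcut_volume_arc :
    ∀ a c : ℝ, MeasureTheory.volume {p : Fin 2 → ℝ | 0 < p 1 ∧ (p 0 - a) ^ 2 + p 1 ^ 2 = c} = 0 := by
  intro a c
  set s : Set (Fin 2 → ℝ) := {p | 0 < p 1 ∧ (p 0 - a) ^ 2 + p 1 ^ 2 = c} with hs
  have hmeas : MeasurableSet s := by
    refine (measurableSet_lt measurable_const (measurable_pi_apply 1)).inter ?_
    exact measurableSet_eq_fun (by fun_prop) measurable_const
  rw [← (volume_preserving_finTwoArrow ℝ).symm.measure_preimage_equiv s,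
    show (volume : Measure (ℝ × ℝ)) = (volume : Measure ℝ).prod volume from rfl,
    Measure.measure_prod_null (hmeas.preimage (MeasurableEquiv.measurable _))]
  refine Filter.Eventually.of_forall fun x => ?_
  refine Set.Subsingleton.measure_zero ?_ volume
  intro t ht t' ht'
  simp only [mem_preimage, hs, mem_setOf_eq] at ht ht'
  simp at ht ht'
  nlinarith [ht.1, ht'.1, ht.2, ht'.2]

/-- The vertical strip `{u < x < v}` over real algebraic `u, v` is `ℚ`-semialgebraic.
[cite: KontsevichZagier2001, §1.1] -/
theorem vcut_isSemialgebraic_strip {u v : ℝ} (hu : IsAlgebraic ℚ u) (hv : IsAlgebraic ℚ v) :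
    IsSemialgebraic ℚ {p : Fin 2 → ℝ | p 0 ∈ Ioo u v} := by
  have hU : IsSemialgebraic ℚ (univ : Set (Fin 2 → ℝ)) := isSemialgebraic_univ
  have h1 := isSemialgebraic_setOf_lt_of_isSemialgebraicFunOn
    (isSemialgebraicFunOn_const_of_isAlgebraic hU hu) (isSemialgebraicFunOn_apply_univ (0 : Fin 2))
  have h2 := isSemialgebraic_setOf_lt_of_isSemialgebraicFunOn
    (isSemialgebraicFunOn_apply_univ (0 : Fin 2)) (isSemialgebraicFunOn_const_of_isAlgebraic hU hv)
  convert h1.inter h2 using 1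
  ext p
  simp

/-! ## Two moves of the calculus -/

/-- Domain additivity up to null sets with two pieces: if `r₁.domain, r₂.domain ⊆ r.domain` meet in
a null set and cover `r.domain` up to a null set, and the integrands agree, then
`[r] − [r₁] − [r₂] ∈ relations` (co-null restriction followed by one rule-(1a) move).
[cite: KontsevichZagier2001, §1.2 rule (1)] -/
theorem vcut_two_piece {n : ℕ} (r r₁ r₂ : KZ.IntegralRep n) (h₁ : r₁.domain ⊆ r.domain)
    (h₂ : r₂.domain ⊆ r.domain) (hnull : volume (r.domain \ (r₁.domain ∪ r₂.domain)) = 0)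
    (hdisj : volume (r₁.domain ∩ r₂.domain) = 0) (e₁ : EqOn r.integrand r₁.integrand r₁.domain)
    (e₂ : EqOn r.integrand r₂.integrand r₂.domain) :
    KZ.of r - KZ.of r₁ - KZ.of r₂ ∈ KZ.relations := by
  have hU : IsSemialgebraic ℚ (r₁.domain ∪ r₂.domain) :=
    r₁.isSemialgebraic_domain.union r₂.isSemialgebraic_domain
  have hsub : r₁.domain ∪ r₂.domain ⊆ r.domain := union_subset h₁ h₂
  have e0 := r.of_sub_of_restrict_mem_relations hU hsub hnull
  have e3 : KZ.of (r.restrict _ hU hsub) - KZ.of r₁ - KZ.of r₂ ∈ KZ.relations :=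
    KZ.domainAddRel_subset_relations ⟨n, r.restrict _ hU hsub, r₁, r₂, rfl, hdisj, e₁, e₂, rfl⟩
  have : KZ.of r - KZ.of r₁ - KZ.of r₂ = (KZ.of r - KZ.of (r.restrict _ hU hsub)) +
      (KZ.of (r.restrict _ hU hsub) - KZ.of r₁ - KZ.of r₂) := by abel
  rw [this]
  exact add_mem e0 e3

/-- Re-indexing a finite signed family of V-piece representations by `Fin m`. [folklore] -/
theorem vcut_flatten {ι : Type} [Fintype ι] (V : ℝ → ℝ → ℝ → ℝ → Set (Fin 2 → ℝ))
    (x : KZ.FormalRep) (α β a c : ι → ℝ) (s : ι → ℤ) (W : ι → KZ.IntegralRep 2)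
    (hdata : ∀ l, IsAlgebraic ℚ (α l) ∧ IsAlgebraic ℚ (β l) ∧ IsAlgebraic ℚ (a l) ∧
      IsAlgebraic ℚ (c l) ∧ α l < β l ∧ (α l - a l) ^ 2 ≤ c l ∧ (β l - a l) ^ 2 ≤ c l)
    (hW : ∀ l, (W l).domain = V (α l) (β l) (a l) (c l) ∧ (W l).integrand = fun p => 1 / p 1 ^ 2)
    (hrel : x - ∑ l, s l • KZ.of (W l) ∈ KZ.relations) :
    ∃ (m : ℕ) (α β a c : Fin m → ℝ) (s : Fin m → ℤ) (W : Fin m → KZ.IntegralRep 2),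
      (∀ j, IsAlgebraic ℚ (α j) ∧ IsAlgebraic ℚ (β j) ∧ IsAlgebraic ℚ (a j) ∧ IsAlgebraic ℚ (c j) ∧
        α j < β j ∧ (α j - a j) ^ 2 ≤ c j ∧ (β j - a j) ^ 2 ≤ c j) ∧
      (∀ j, (W j).domain = V (α j) (β j) (a j) (c j) ∧ (W j).integrand = fun p => 1 / p 1 ^ 2) ∧
      x - ∑ j, s j • KZ.of (W j) ∈ KZ.relations := by
  set e := Fintype.equivFin ι
  refine ⟨Fintype.card ι, α ∘ e.symm, β ∘ e.symm, a ∘ e.symm, c ∘ e.symm, s ∘ e.symm, W ∘ e.symm,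
    fun j => hdata _, fun j => hW _, ?_⟩
  have hs : ∑ j, (s ∘ e.symm) j • KZ.of ((W ∘ e.symm) j) = ∑ l, s l • KZ.of (W l) :=
    e.symm.sum_comp (fun l => s l • KZ.of (W l))
  rwa [hs]

end Summit.KontsevichZagierPeriods.HyperbolicBloch.OffTetraSectorKernel

end
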